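import Summits.MatrixMultiplication.MatrixMultiplication.Theorems.SoloInformedValNormalForm

/-!
# Pratt's Conjecture 4.1 is false (file 3 of 3)

K. Pratt, *On generalized corners and matrix multiplication*, arXiv:2309.03878, Conjecture 4.1 ("our weakest
conjecture"): for all `ε > 0`, `Val(ℤ_N) ≤ O(N^{1+ε})`, where `Val(ℤ_N)` (Definition 3.2) is the maximum number of
solutions of `a + b + c = 0` over equilateral trapezoid-free triples `(A, B, C)` of subsets of `ℤ_N`.

This file states Definition 3.2 over an arbitrary additive commutative group (`TrapezoidFreeG`, `solutionsG`;
on `ℤ` they are *definitionally* the `TrapezoidFree`/`solutions` of `SoloInformedValTrapezoid`), performs the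
embedding `{0,…,n} → ℤ_{3n}`, `A ↦ A + 2n` of [Pratt, Prop. 4.3 (2)] (`config_embed`), and combines it with the
family `val_family` of `SoloInformedValNormalForm` (`54000^{m+1}` solutions at modulus `53345^{m+1} - 1`) to prove
`¬ PrattConjecture41` (`prattConjecture41_false`): along `N_m = 3 (53345^{m+1} - 1)` one has
`Val(ℤ_{N_m}) ≥ 54000^{m+1} = ((N_m+3)/3)^κ`, `κ = log 54000 / log 53345 > 1`.

solo-informed MatrixMultiplication, gen 65.  References: Pratt arXiv:2309.03878 Def 3.2, Conj 4.1, Prop 4.3;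
Cohn–Kleinberg–Szegedy–Umans arXiv:math/0511460 Thm 33 (the STPP behind the base instance).
-/

namespace Summit.MatrixMultiplication.MatrixMultiplication.Theorems.SoloVal

open Finset

section General

variable {G : Type*} [AddCommGroup G] [DecidableEq G]

/-- [Pratt, Def. 3.2] in an additive commutative group `G`, with target `t` (Pratt: `t = 0`): for all fixed
`a' ∈ A`, `b' ∈ B`, `c' ∈ C` each of the systems (1) `t = a'+b+c = a+b'+c`, (2) `t = a'+b+c = a+b+c'`,
(3) `t = a+b'+c = a+b+c'` has at most one solution `(a,b,c) ∈ A × B × C`; system (1) is determined by `c`,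
(2) by `b`, (3) by `a`, and "at most one solution" is uniqueness of that coordinate. -/
def TrapezoidFreeG (A B C : Finset G) (t : G) : Prop :=
  (∀ a' ∈ A, ∀ b' ∈ B, ∀ c₁ ∈ C, ∀ c₂ ∈ C,
      t - a' - c₁ ∈ B → t - b' - c₁ ∈ A → t - a' - c₂ ∈ B → t - b' - c₂ ∈ A → c₁ = c₂) ∧
  (∀ a' ∈ A, ∀ c' ∈ C, ∀ b₁ ∈ B, ∀ b₂ ∈ B,
      t - a' - b₁ ∈ C → t - c' - b₁ ∈ A → t - a' - b₂ ∈ C → t - c' - b₂ ∈ A → b₁ = b₂) ∧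
  (∀ b' ∈ B, ∀ c' ∈ C, ∀ a₁ ∈ A, ∀ a₂ ∈ A,
      t - b' - a₁ ∈ C → t - c' - a₁ ∈ B → t - b' - a₂ ∈ C → t - c' - a₂ ∈ B → a₁ = a₂)

/-- The solutions of `a + b + c = t` in `A × B × C` (group version). -/
def solutionsG (A B C : Finset G) (t : G) : Finset (G × G × G) :=
  (A ×ˢ B ×ˢ C).filter (fun p => p.1 + p.2.1 + p.2.2 = t)

end General

/-- On `ℤ` the group version is definitionally the integer version of file 1. -/
theorem trapezoidFreeG_int_iff (A B C : Finset ℤ) (t : ℤ) :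
    TrapezoidFreeG A B C t ↔ TrapezoidFree A B C t := Iff.rfl

/-- On `ℤ` the solution sets agree definitionally. -/
theorem solutionsG_int (A B C : Finset ℤ) (t : ℤ) : solutionsG A B C t = solutions A B C t := rfl

/-- Pratt's Conjecture 4.1 [arXiv:2309.03878]: for every `ε > 0` there is a constant `K` such that every
equilateral trapezoid-free triple in `ℤ_N` (`N ≥ 1`) has at most `K · N^{1+ε}` solutions of `a + b + c = 0`,
i.e. `Val(ℤ_N) ≤ O_ε(N^{1+ε})`. -/
def PrattConjecture41 : Prop :=
  ∀ ε : ℝ, 0 < ε → ∃ K : ℝ, ∀ N : ℕ, 0 < N → ∀ A B C : Finset (ZMod N),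
    TrapezoidFreeG A B C (0 : ZMod N) → ((solutionsG A B C (0 : ZMod N)).card : ℝ) ≤ K * (N : ℝ) ^ (1 + ε)

section Embedding

/-- The cast `ℤ → ℤ_{3n}`. -/
def π (n : ℕ) (z : ℤ) : ZMod (3 * n) := (z : ZMod (3 * n))

/-- `A ↦ (A + 2n) mod 3n`. -/
noncomputable def embA (n : ℕ) (A : Finset ℤ) : Finset (ZMod (3 * n)) := A.image (fun a => π n (a + 2 * n))

/-- `S ↦ S mod 3n`. -/
noncomputable def embS (n : ℕ) (S : Finset ℤ) : Finset (ZMod (3 * n)) := S.image (π n)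

/-- A multiple of `3n` in `[2n, 5n]` is `3n` (`n ≥ 1`). -/
theorem eq_three_mul {n : ℕ} (hn : 0 < n) {z : ℤ} (h : (3 * (n : ℤ)) ∣ z) (h1 : 2 * (n : ℤ) ≤ z)
    (h2 : z ≤ 5 * n) : z = 3 * n := by
  obtain ⟨k, hk⟩ := h
  have hn' : (0 : ℤ) < n := by exact_mod_cast hn
  by_cases hk0 : k ≤ 0
  · nlinarith
  by_cases hk2 : 2 ≤ k
  · nlinarith
  have : k = 1 := by omega
  subst this; simpa using hk

/-- A multiple of `3n` in `[-n, n]` is `0` (`n ≥ 1`). -/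
theorem eq_zero_of_dvd {n : ℕ} (hn : 0 < n) {d : ℤ} (h : (3 * (n : ℤ)) ∣ d) (h1 : -(n : ℤ) ≤ d)
    (h2 : d ≤ n) : d = 0 := by
  obtain ⟨k, hk⟩ := h
  have hn' : (0 : ℤ) < n := by exact_mod_cast hn
  by_cases hk0 : k ≤ -1
  · nlinarith
  by_cases hk2 : 1 ≤ k
  · nlinarith
  have : k = 0 := by omega
  subst this; simpa using hk

/-- `π n z = 0 ↔ 3n ∣ z`. -/
theorem pi_eq_zero_iff {n : ℕ} {z : ℤ} : π n z = 0 ↔ (3 * (n : ℤ)) ∣ z := by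
  unfold π
  have h := ZMod.intCast_eq_intCast_iff_dvd_sub z 0 (3 * n)
  push_cast at h
  rw [h, zero_sub, dvd_neg]

/-- `π n` is injective on `[0, n]` up to a common shift (`n ≥ 1`). -/
theorem pi_inj {n : ℕ} (hn : 0 < n) {x y s : ℤ} (hx : 0 ≤ x ∧ x ≤ n) (hy : 0 ≤ y ∧ y ≤ n)
    (h : π n (x + s) = π n (y + s)) : x = y := by
  unfold π at h
  have h' := (ZMod.intCast_eq_intCast_iff_dvd_sub (x + s) (y + s) (3 * n)).mp h
  push_cast at h'
  have e : y + s - (x + s) = y - x := by ring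
  rw [e] at h'
  have := eq_zero_of_dvd hn h' (by linarith [hx.2, hy.1]) (by linarith [hx.1, hy.2])
  linarith

/-- Lift of a membership `0 - π(x + 2n) - π y ∈ embS n S` (`x, y ∈ [0,n]`, `S ⊆ [0,n]`): `n - x - y ∈ S`. -/
theorem lift_S {n : ℕ} (hn : 0 < n) {S : Finset ℤ} (hS : ∀ s ∈ S, 0 ≤ s ∧ s ≤ n) {x y : ℤ}
    (hx : 0 ≤ x ∧ x ≤ n) (hy : 0 ≤ y ∧ y ≤ n)
    (h : (0 : ZMod (3 * n)) - π n (x + 2 * n) - π n y ∈ embS n S) : (n : ℤ) - x - y ∈ S := by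
  rw [embS, mem_image] at h
  obtain ⟨s, hs, hse⟩ := h
  have h0 : π n (s + (x + 2 * n) + y) = 0 := by
    unfold π at hse ⊢; push_cast at hse ⊢; rw [hse]; ring
  rw [pi_eq_zero_iff] at h0
  have h3 := eq_three_mul hn h0 (by linarith [(hS s hs).1, hx.1, hy.1])
    (by linarith [(hS s hs).2, hx.2, hy.2])
  have : s = n - x - y := by linarith
  rw [← this]; exact hs

/-- Lift of a membership `0 - π x - π y ∈ embA n A` (`x, y ∈ [0,n]`, `A ⊆ [0,n]`): `n - x - y ∈ A`. -/
theorem lift_A {n : ℕ} (hn : 0 < n) {A : Finset ℤ} (hA : ∀ a ∈ A, 0 ≤ a ∧ a ≤ n) {x y : ℤ}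
    (hx : 0 ≤ x ∧ x ≤ n) (hy : 0 ≤ y ∧ y ≤ n)
    (h : (0 : ZMod (3 * n)) - π n x - π n y ∈ embA n A) : (n : ℤ) - x - y ∈ A := by
  rw [embA, mem_image] at h
  obtain ⟨a, ha, hae⟩ := h
  have h0 : π n (a + 2 * n + x + y) = 0 := by
    unfold π at hae ⊢; push_cast at hae ⊢; rw [hae]; ring
  rw [pi_eq_zero_iff] at h0
  have h3 := eq_three_mul hn h0 (by linarith [(hA a ha).1, hx.1, hy.1])
    (by linarith [(hA a ha).2, hx.2, hy.2])
  have : a = n - x - y := by linarith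
  rw [← this]; exact ha

/-- [Pratt, Prop. 4.3 (2)]: a configuration of modulus `n ≥ 1` embeds into `ℤ_{3n}` as an equilateral
trapezoid-free triple with target `0` and at least as many solutions (`A ↦ A + 2n`: every sum involved lies in
`[2n, 5n]`, so `≡ 0 (mod 3n)` forces `= 3n`). -/
theorem config_embed {A B C : Finset ℤ} {n : ℕ} (hn : 0 < n) (hc : Config A B C n) :
    TrapezoidFreeG (embA n A) (embS n B) (embS n C) (0 : ZMod (3 * n)) ∧
      (solutions A B C n).card ≤
        (solutionsG (embA n A) (embS n B) (embS n C) (0 : ZMod (3 * n))).card := by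
  obtain ⟨-, ⟨h1, h2, h3⟩, hA, hB, hC, -⟩ := hc
  refine ⟨⟨?_, ?_, ?_⟩, ?_⟩
  · intro a' ha' b' hb' c₁ hc₁ c₂ hc₂ m1 m2 m3 m4
    rw [embA, mem_image] at ha'; obtain ⟨a₀, ha₀, rfl⟩ := ha'
    rw [embS, mem_image] at hb' hc₁ hc₂
    obtain ⟨b₀, hb₀, rfl⟩ := hb'; obtain ⟨u, hu, rfl⟩ := hc₁; obtain ⟨v, hv, rfl⟩ := hc₂
    have k1 := lift_S hn hB (hA a₀ ha₀) (hC u hu) m1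
    have k2 := lift_A hn hA (hB b₀ hb₀) (hC u hu) m2
    have k3 := lift_S hn hB (hA a₀ ha₀) (hC v hv) m3
    have k4 := lift_A hn hA (hB b₀ hb₀) (hC v hv) m4
    rw [h1 a₀ ha₀ b₀ hb₀ u hu v hv k1 k2 k3 k4]
  · intro a' ha' c' hc' b₁ hb₁ b₂ hb₂ m1 m2 m3 m4
    rw [embA, mem_image] at ha'; obtain ⟨a₀, ha₀, rfl⟩ := ha'
    rw [embS, mem_image] at hc' hb₁ hb₂
    obtain ⟨c₀, hc₀, rfl⟩ := hc'; obtain ⟨u, hu, rfl⟩ := hb₁; obtain ⟨v, hv, rfl⟩ := hb₂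
    have k1 := lift_S hn hC (hA a₀ ha₀) (hB u hu) m1
    have k2 := lift_A hn hA (hC c₀ hc₀) (hB u hu) m2
    have k3 := lift_S hn hC (hA a₀ ha₀) (hB v hv) m3
    have k4 := lift_A hn hA (hC c₀ hc₀) (hB v hv) m4
    rw [h2 a₀ ha₀ c₀ hc₀ u hu v hv k1 k2 k3 k4]
  · intro b' hb' c' hc' a₁ ha₁ a₂ ha₂ m1 m2 m3 m4
    rw [embS, mem_image] at hb' hc'
    obtain ⟨b₀, hb₀, rfl⟩ := hb'; obtain ⟨c₀, hc₀, rfl⟩ := hc'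
    rw [embA, mem_image] at ha₁ ha₂
    obtain ⟨u, hu, rfl⟩ := ha₁; obtain ⟨v, hv, rfl⟩ := ha₂
    rw [sub_right_comm] at m1 m2 m3 m4
    have k1 := lift_S hn hC (hA u hu) (hB b₀ hb₀) m1
    have k2 := lift_S hn hB (hA u hu) (hC c₀ hc₀) m2
    have k3 := lift_S hn hC (hA v hv) (hB b₀ hb₀) m3
    have k4 := lift_S hn hB (hA v hv) (hC c₀ hc₀) m4
    have e1 : (n : ℤ) - b₀ - u = n - u - b₀ := by ring
    have e2 : (n : ℤ) - c₀ - u = n - u - c₀ := by ring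
    have e3 : (n : ℤ) - b₀ - v = n - v - b₀ := by ring
    have e4 : (n : ℤ) - c₀ - v = n - v - c₀ := by ring
    rw [h3 b₀ hb₀ c₀ hc₀ u hu v hv (e1 ▸ k1) (e2 ▸ k2) (e3 ▸ k3) (e4 ▸ k4)]
  · refine card_le_card_of_injOn (fun p => (π n (p.1 + 2 * n), π n p.2.1, π n p.2.2)) ?_ ?_
    · intro p hp
      rw [mem_coe, solutions, mem_filter, mem_product, mem_product] at hp
      obtain ⟨⟨hpa, hpb, hpc⟩, hsum⟩ := hp
      rw [mem_coe, solutionsG, mem_filter, mem_product, mem_product]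
      refine ⟨⟨mem_image_of_mem _ hpa, mem_image_of_mem _ hpb, mem_image_of_mem _ hpc⟩, ?_⟩
      show π n (p.1 + 2 * n) + π n p.2.1 + π n p.2.2 = 0
      have e : π n (p.1 + 2 * n) + π n p.2.1 + π n p.2.2 = π n (p.1 + 2 * n + p.2.1 + p.2.2) := by
        unfold π; push_cast; ring
      rw [e, pi_eq_zero_iff]
      exact ⟨1, by linarith [hsum]⟩
    · intro p hp q hq hpq
      rw [mem_coe, solutions, mem_filter, mem_product, mem_product] at hp hq
      simp only [Prod.mk.injEq] at hpq
      obtain ⟨e1, e2, e3⟩ := hpq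
      have q1 := pi_inj hn (hA _ hp.1.1) (hA _ hq.1.1) e1
      have q2 := pi_inj hn (s := 0) (hB _ hp.1.2.1) (hB _ hq.1.2.1) (by simpa using e2)
      have q3 := pi_inj hn (s := 0) (hC _ hp.1.2.2) (hC _ hq.1.2.2) (by simpa using e3)
      exact Prod.ext q1 (Prod.ext q2 q3)

end Embedding

/-- The cyclic-group family: for every `m` an equilateral trapezoid-free triple in `ℤ_{3(53345^{m+1}-1)}` with
at least `54000^{m+1}` solutions of `a + b + c = 0`. -/
theorem val_cyclic_family (m : ℕ) : ∃ n : ℕ, (n : ℤ) + 1 = 53345 ^ (m + 1) ∧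
    ∃ A B C : Finset (ZMod (3 * n)), TrapezoidFreeG A B C 0 ∧
      54000 ^ (m + 1) ≤ (solutionsG A B C 0).card := by
  obtain ⟨A, B, C, N, hN, hc, hcard⟩ := val_family m
  have hN0 : 0 ≤ N := hc.1
  have hNn : ((N.toNat : ℕ) : ℤ) = N := Int.toNat_of_nonneg hN0
  have hpos : 0 < N.toNat := by
    have h1 : (53345 : ℤ) ^ 1 ≤ 53345 ^ (m + 1) := pow_le_pow_right₀ (by norm_num) (by omega)
    have : (1 : ℤ) ≤ N := by linarith
    omega
  rw [← hNn] at hc hcard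
  obtain ⟨htf, hle⟩ := config_embed hpos hc
  exact ⟨N.toNat, by rw [hNn]; exact hN, embA _ A, embS _ B, embS _ C, htf, hcard.trans hle⟩

/-- **Pratt's Conjecture 4.1 is false.** -/
theorem prattConjecture41_false : ¬ PrattConjecture41 := by
  intro h
  have hκ1 : 1 < Real.logb 53345 54000 := one_lt_kappa
  obtain ⟨K, hK⟩ := h ((Real.logb 53345 54000 - 1) / 2) (by linarith)
  set κ := Real.logb 53345 54000 with hκ
  set ε := (κ - 1) / 2 with hε
  have hb : (0 : ℝ) < 53345 := by norm_num
  have h54 : (53345 : ℝ) ^ κ = 54000 := Real.rpow_logb hb (by norm_num) (by norm_num)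
  have hε1 : (0 : ℝ) ≤ 1 + ε := by rw [hε]; linarith
  -- the per-`m` inequality
  have step : ∀ m : ℕ, ((53345 : ℝ) ^ κ) ^ (m + 1) ≤
      K * (3 : ℝ) ^ (1 + ε) * ((53345 : ℝ) ^ (1 + ε)) ^ (m + 1) := by
    intro m
    obtain ⟨n, hn, A, B, C, htf, hcard⟩ := val_cyclic_family m
    have hn1 : (1 : ℤ) ≤ n := by
      have h1 : (53345 : ℤ) ^ 1 ≤ 53345 ^ (m + 1) := pow_le_pow_right₀ (by norm_num) (by omega)
      linarith
    have hNpos : 0 < 3 * n := by omega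
    have hKm := hK (3 * n) hNpos A B C htf
    have hcardR : (54000 : ℝ) ^ (m + 1) ≤ ((solutionsG A B C 0).card : ℝ) := by exact_mod_cast hcard
    have hnR : ((3 * n : ℕ) : ℝ) ≤ 3 * (53345 : ℝ) ^ (m + 1) := by
      have : ((n : ℤ) : ℝ) + 1 = ((53345 : ℤ) : ℝ) ^ (m + 1) := by exact_mod_cast hn
      push_cast at this ⊢; linarith
    have hpow : ((3 * n : ℕ) : ℝ) ^ (1 + ε) ≤ (3 * (53345 : ℝ) ^ (m + 1)) ^ (1 + ε) :=
      Real.rpow_le_rpow (by positivity) hnR hε1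
    have hsplit : (3 * (53345 : ℝ) ^ (m + 1)) ^ (1 + ε) =
        (3 : ℝ) ^ (1 + ε) * ((53345 : ℝ) ^ (1 + ε)) ^ (m + 1) := by
      rw [Real.mul_rpow (by norm_num) (by positivity)]
      congr 1
      rw [← Real.rpow_natCast (53345 : ℝ) (m + 1), ← Real.rpow_mul hb.le, mul_comm, Real.rpow_mul hb.le,
        Real.rpow_natCast]
    have hK0 : 0 ≤ K := by
      by_contra hneg
      have hneg : K < 0 := not_le.mp hneg
      have h0 : (0 : ℝ) < (54000 : ℝ) ^ (m + 1) := by positivity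
      have h1 : (0 : ℝ) < ((3 * n : ℕ) : ℝ) ^ (1 + ε) := Real.rpow_pos_of_pos (by exact_mod_cast hNpos) _
      have : K * ((3 * n : ℕ) : ℝ) ^ (1 + ε) < 0 := mul_neg_of_neg_of_pos hneg h1
      linarith [hcardR.trans hKm]
    calc ((53345 : ℝ) ^ κ) ^ (m + 1) = (54000 : ℝ) ^ (m + 1) := by rw [h54]
      _ ≤ K * ((3 * n : ℕ) : ℝ) ^ (1 + ε) := hcardR.trans hKm
      _ ≤ K * (3 * (53345 : ℝ) ^ (m + 1)) ^ (1 + ε) := mul_le_mul_of_nonneg_left hpow hK0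
      _ = K * (3 : ℝ) ^ (1 + ε) * ((53345 : ℝ) ^ (1 + ε)) ^ (m + 1) := by rw [hsplit, mul_assoc]
  -- the ratio `r = 53345^{κ-1-ε} > 1` has bounded powers: contradiction
  have hv0 : 0 < (53345 : ℝ) ^ (1 + ε) := Real.rpow_pos_of_pos hb _
  have hr1 : 1 < (53345 : ℝ) ^ (κ - (1 + ε)) := Real.one_lt_rpow (by norm_num) (by rw [hε]; linarith)
  have hru : (53345 : ℝ) ^ κ = (53345 : ℝ) ^ (κ - (1 + ε)) * (53345 : ℝ) ^ (1 + ε) := by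
    rw [← Real.rpow_add hb]; congr 1; ring
  have bound : ∀ m : ℕ, ((53345 : ℝ) ^ (κ - (1 + ε))) ^ (m + 1) ≤ K * (3 : ℝ) ^ (1 + ε) := by
    intro m
    have hs := step m
    rw [hru, mul_pow] at hs
    exact le_of_mul_le_mul_right (by linarith [hs]) (pow_pos hv0 _)
  obtain ⟨M, hM⟩ := pow_unbounded_of_one_lt (K * (3 : ℝ) ^ (1 + ε)) hr1
  have hmono : ((53345 : ℝ) ^ (κ - (1 + ε))) ^ M ≤ ((53345 : ℝ) ^ (κ - (1 + ε))) ^ (M + 1) :=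
    pow_le_pow_right₀ hr1.le (by omega)
  linarith [bound M]

end Summit.MatrixMultiplication.MatrixMultiplication.Theorems.SoloVal
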